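import Summits.QuantumFields.YangMills.Theorems.BalabanUVNodesN15KingModelB9Thm31AtTrivialU
import Summits.QuantumFields.YangMills.Theorems.BalabanUVNodesN15KingModelFullPropagatorMixedHolderOperator

/-!
# BalabanUVNodes ∕ N15 — THE KING-MODEL RUNG, CURVED EDITION (PACKAGE, SECOND HALF): [B9] THEOREM 3.1 AT `U ≡ 1` FOR KING'S FULL `A = 0` PROPAGATOR —
# (3.45) IN THE PRINTED EXPONENT BOOKKEEPING (`β`-Hölder norm by the `(β + ε)`-modulus), AND ALL FOUR sup ∕ Hölder ENTRIES (3.43)₁ ∧ (3.43)₂ ∧ (3.44) ∧ (3.45)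
# UNDER ONE `(C, δ)`
# (Track A, DAG node N15 = NE2; FAN-OUT v1.1 §N15 s3 «KING-MODEL RUNG … + the one-line statement of what the curved case adds»)

HONEST FRAMING.  Count-neutral PACKAGING (cell `pub-ymgap`, seat `pub-ymgap-dag-n15-e` g10; `--supports stmt-QuantumFields-20544 --as helper` = K3⁷
`SpineGivenEndpointR13SepCoPH`, WORDS-143).  TEMPLATE LITERATURE, `A = 0`: C. King's scalar U(1)-Higgs MODEL on finite tori ([King1986] (2.13) p. 653, Thm 3.3
(3.8) p. 656, Prop. 3.7 (3.63)∕(3.65) p. 663), NOT Bałaban's covariant objects.  [Balaban1985BackgroundPropagators] Thm 3.1 pp. 397–398 prints for `G(U)` the sup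
entries (3.42), the Hölder norms (3.43) `‖ζ∇_UGλ‖_α, ‖ζG∇*_Uλ‖_α`, the mixed sup (3.44) `|∇_UG∇*_Uλ|` (with `‖λ‖_ε`), its Hölder norm (3.45)
«`‖ζ∇_UG(U)∇*_Uλ‖_α ≤ B′₀(ε, α)(L^jη)^{−α}(‖ζ‖^ξ_α + |ζ|)e^{−δ₀d(y, y′)}(‖λ‖_{α+ε} + |λ|)`», and the `L²` bounds (3.46)–(3.47).  For King's FULL `A = 0` propagator
`A₀⁻¹ = G_K(T_ε, 0)` at `U ≡ 1` the tree decides: (3.43)₁ (U-ii `fineOp_inv_deriv_holder_decay_unif`), (3.43)₂ (W-b `fullPropAdjOp_holder_le`), (3.44) (V-b∕V-c),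
(3.45) (Ψ-c `fullPropMixedOp_holderNorm_le`, sharp: `C^α → C^α`), (3.46)–(3.47) (X `fullPropOps_l2_unif`).  THIS FILE: §1 the PRINTED exponent bookkeeping of (3.45)
(`β`-norm of the mixed object by the `(β + ε)`-modulus of the source, `β + ε < 1`, `|x − x′| ≤ N`); §2 the four sup ∕ Hölder entries under ONE `(C, δ)` — the citable
name for N15 consumers, extending part PACKAGE `kingFullProp_B9Thm31_sup_holder_at_trivialU` by (3.45).  Decided in the MODEL at `U ≡ 1`; NOT the printed proposition
(covariant `G(U)` over `Reg335`, multiscale carrier, cut-offs `ζ`); NE2⁺ is NOT PRINTED and not proved; NOT a node discharge; count-neutral; nothing continuum ∕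
ℝ⁴ ∕ OS ∕ mass-gap ∕ Clay.  0 `sorry`, 0 `def`, standard axioms.
* §1 ★ `fullPropMixedOp_holderNorm_le_printed`; §2 ★★ **`kingFullProp_B9Thm31_holder_at_trivialU`**.
WHAT THE CURVED CASE ADDS (one line): Theorem 3.1 itself — the same five displays for `G(U)`, `U` over `Reg335`, multiscale sites, cut-offs, analyticity in `U` (Thm 3.4).
HONEST SCOPE.  (i) `A = 0`, periodic b.c., odd `L ≥ 3`, cubes `2L^e`, `K ≥ 1`, `0 < m² ≤ m₀²`, `d ≥ 1`; (ii) King's spelling, forward η-differences, lattice units of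
level `K`, sup torus distance; (iii) GLOBAL Hölder modulus ∕ sup norm of the source (no `|λ|` companion term, `ζ ≡ 1`); (iv) `0 < α < 1`, `0 < ε ≤ 1`; (v) not
Bałaban's `G(U)`; not a discharge.
Locators: [Balaban1985BackgroundPropagators] Thm 3.1 (3.39)–(3.41) p. 397, (3.42)–(3.47) p. 398; [King1986] (2.13) p. 653, Thm 3.3 (3.8) p. 656, (3.62), Prop. 3.7
(3.63)∕(3.65) p. 663; [Balaban1983RegularityDecay] Theorem (1.9)–(1.10) p. 573.
-/

noncomputable section

namespace Summit.QuantumFields.YangMills.BalabanUVNodes.N15KingModelRung.Curved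

open Real Finset Matrix
open Literature.MathematicalPhysics.QuantumFieldTheory.Balaban1983to89.B5Prop11Plancherel (Tor fine unitVec)
open Literature.MathematicalPhysics.QuantumFieldTheory.King1986 (aK aK_pos)
open Literature.MathematicalPhysics.QuantumFieldTheory.King1986.Torus (fineOp constrainedProp blockOf tdistT tdistT_nonneg tdistT_symm tdistT_self)

variable {d : ℕ} (L : ℕ) [NeZero L]

/-! ## §1 (3.45) at `U ≡ 1` in the printed exponent bookkeeping -/

/-- ★ **[B9] (3.45) AT `U ≡ 1`, PRINTED EXPONENTS**: for `d ≥ 1`, odd `L ≥ 3`, `a > 0`, `m₀² ≥ 0`, `0 ≤ β`, `0 < ε` with `β + ε < 1` there are `C, δ > 0` such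
that for EVERY `K ≥ 1` (`N = L^K`), cube `2L^e`, mass `0 < m² ≤ m₀²`, directions `μ, μ′`, every source `λ` with `(β + ε)`-Hölder modulus `H`
(`|λ(y) − λ(y′)| ≤ H·(|y − y′|∕N)^{β+ε}`), all `x, x′` with `|x − x′| ≤ N` and every `D` with `D ≤ |B(x) − B(y)|, |B(x′) − B(y)|` on `supp λ`:
`(|x − x′|∕N)^{−β}·|F(x′) − F(x)| ≤ C·H·e^{−δD}`, `F(x) = N·((A₀⁻¹∇*_μλ)(x + e_μ′) − (A₀⁻¹∇*_μλ)(x))` — the printed shape «`‖·‖_β ≤ B′₀(ε, β)(…)(‖λ‖_{β+ε} + |λ|)`»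
at `U ≡ 1`, from the sharp Ψ-c `fullPropMixedOp_holderNorm_le` at `α = β + ε` and `(ρ∕N)^{−β} ≤ (ρ∕N)^{−(β+ε)}` for `ρ ≤ N`.
[cite: Balaban1985BackgroundPropagators, Thm 3.1 (3.45) p.398, (3.40) p.397; King1986, (2.13) p.653, Prop. 3.7 (3.65) p.663] -/
theorem fullPropMixedOp_holderNorm_le_printed (hd : 1 ≤ d) (hLodd : Odd L) (hL : 2 ≤ L) {a : ℝ} (ha : 0 < a) {m0sq : ℝ} (hm0 : 0 ≤ m0sq)
    {β ε : ℝ} (hβ : 0 ≤ β) (hε : 0 < ε) (hβε : β + ε < 1) :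
    ∃ C δ : ℝ, 0 < C ∧ 0 < δ ∧ ∀ (K : ℕ), 1 ≤ K → ∀ (N : ℕ) [NeZero N], N = L ^ K →
      ∀ (e : ℕ) (M : Fin (d + 1) → ℕ) [∀ μ, NeZero (M μ)], (∀ μ, M μ = 2 * L ^ e) →
      ∀ (msq : ℝ), 0 < msq → msq ≤ m0sq → ∀ (μ μ' : Fin (d + 1)) (lam : Tor (fine N M) → ℝ) (H : ℝ),
        0 ≤ H → (∀ y y', |lam y - lam y'| ≤ H * (tdistT (fine N M) y y' / (N : ℝ)) ^ (β + ε)) →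
        ∀ (x x' : Tor (fine N M)), tdistT (fine N M) x x' ≤ (N : ℝ) → ∀ (D : ℝ),
        (∀ y, lam y ≠ 0 → D ≤ tdistT M (blockOf N M x) (blockOf N M y)) →
        (∀ y, lam y ≠ 0 → D ≤ tdistT M (blockOf N M x') (blockOf N M y)) →
        (tdistT (fine N M) x x' / (N : ℝ)) ^ (-β) *
          |((N : ℝ) * (((fineOp N M (aK a L K) (((N : ℕ) : ℝ) ^ 2) msq)⁻¹
                *ᵥ (fun y => (N : ℝ) * (lam (y - unitVec (fine N M) μ) - lam y))) (x' + unitVec (fine N M) μ')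
              - ((fineOp N M (aK a L K) (((N : ℕ) : ℝ) ^ 2) msq)⁻¹
                *ᵥ (fun y => (N : ℝ) * (lam (y - unitVec (fine N M) μ) - lam y))) x'))
           - ((N : ℝ) * (((fineOp N M (aK a L K) (((N : ℕ) : ℝ) ^ 2) msq)⁻¹
                *ᵥ (fun y => (N : ℝ) * (lam (y - unitVec (fine N M) μ) - lam y))) (x + unitVec (fine N M) μ')
              - ((fineOp N M (aK a L K) (((N : ℕ) : ℝ) ^ 2) msq)⁻¹
                *ᵥ (fun y => (N : ℝ) * (lam (y - unitVec (fine N M) μ) - lam y))) x))|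
          ≤ C * H * Real.exp (-(δ * D)) := by
  obtain ⟨C, δ, hC, hδ, HΨ⟩ := fullPropMixedOp_holderNorm_le (d := d) L hd hLodd hL ha hm0 (α := β + ε) (by linarith) hβε
  refine ⟨C, δ, hC, hδ, ?_⟩
  intro K hK N _ hN e M _ hM msq hmsq hcap μ μ' lam H hH0 hH x x' hρN D hDx hDx'
  have h := HΨ K hK N hN e M hM msq hmsq hcap μ μ' lam H hH0 hH x x' D hDx hDx'
  have hN1 : (1 : ℝ) ≤ (N : ℝ) := by rw [hN]; exact_mod_cast Nat.one_le_pow K L (by omega)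
  have hN0 : 0 < (N : ℝ) := by linarith
  by_cases hxx' : x = x'
  · subst hxx'
    rw [sub_self, abs_zero, mul_zero]; positivity
  have hρ1 : 1 ≤ tdistT (fine N M) x x' := one_le_tdistT_of_ne (fine N M) hxx'
  have hq0 : 0 < tdistT (fine N M) x x' / (N : ℝ) := div_pos (by linarith) hN0
  have hq1 : tdistT (fine N M) x x' / (N : ℝ) ≤ 1 := (div_le_one hN0).mpr hρN
  have hexp : (tdistT (fine N M) x x' / (N : ℝ)) ^ (-β) ≤ (tdistT (fine N M) x x' / (N : ℝ)) ^ (-(β + ε)) :=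
    Real.rpow_le_rpow_of_exponent_ge hq0 hq1 (by linarith)
  exact (mul_le_mul_of_nonneg_right hexp (abs_nonneg _)).trans h

/-! ## §2 The four sup ∕ Hölder entries of Theorem 3.1 at `U ≡ 1`, one `(C, δ)` -/

/-- ★★ **[B9] THEOREM 3.1 AT `U ≡ 1` — THE SUP ∕ HÖLDER ENTRIES (3.43)₁, (3.43)₂, (3.44), (3.45) FOR KING'S FULL `A = 0` FLUCTUATION PROPAGATOR, ONE `(C, δ)`.**
For `d ≥ 1`, odd `L ≥ 3`, `a > 0`, `m₀² ≥ 0`, `0 < α < 1` and `0 < ε ≤ 1` there are `C, δ > 0` such that for every `K ≥ 1` (`N = L^K`), cube `M_μ = 2L^e` and mass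
`0 < m² ≤ m₀²`, with `A₀ = fineOp N M a_K N² m²`, `(∇*_νg)(y) = N(g(y − e_ν) − g(y))`, block distance `D ≥ 0` from `{B(x), B(x′)}` to the support:
(3.43)₁ `(|x−x′|∕N)^{−α}|N((A₀⁻¹λ)(x′+e_μ) − (A₀⁻¹λ)(x′)) − N((A₀⁻¹λ)(x+e_μ) − (A₀⁻¹λ)(x))| ≤ C e^{−δD}‖λ‖_∞`;
(3.43)₂ `(|x−x′|∕N)^{−α}|(A₀⁻¹∇*_νλ)(x′) − (A₀⁻¹∇*_νλ)(x)| ≤ C e^{−δD}‖λ‖_∞`;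
(3.44) `|N((A₀⁻¹∇*_μλ)(x+e_μ′) − (A₀⁻¹∇*_μλ)(x))| ≤ C·H·e^{−δD}` for `λ` with ε-Hölder modulus `H`;
(3.45) `(|x−x′|∕N)^{−α}|N((A₀⁻¹∇*_μλ)(x′+e_μ′) − (A₀⁻¹∇*_μλ)(x′)) − N((A₀⁻¹∇*_μλ)(x+e_μ′) − (A₀⁻¹∇*_μλ)(x))| ≤ C·H·e^{−δD}` for `λ` with α-Hölder modulus `H`
(sharp: no `ε`-loss).  The `L²` entries (3.46)–(3.47) are part X `fullPropOps_l2_unif`.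
[cite: Balaban1985BackgroundPropagators, Thm 3.1 (3.43)–(3.45) p.398; Balaban1983RegularityDecay, Theorem (1.9)–(1.10) p.573; King1986, (2.13) p.653, Prop. 3.7 (3.63)/(3.65) p.663] -/
theorem kingFullProp_B9Thm31_holder_at_trivialU (hd : 1 ≤ d) (hLodd : Odd L) (hL : 2 ≤ L) {a : ℝ} (ha : 0 < a) {m0sq : ℝ}
    (hm0 : 0 ≤ m0sq) {α : ℝ} (hα0 : 0 < α) (hα1 : α < 1) {ε : ℝ} (hε0 : 0 < ε) (hε1 : ε ≤ 1) :
    ∃ C δ : ℝ, 0 < C ∧ 0 < δ ∧ ∀ (K : ℕ), 1 ≤ K → ∀ (N : ℕ) [NeZero N], N = L ^ K →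
      ∀ (e : ℕ) (M : Fin (d + 1) → ℕ) [∀ μ, NeZero (M μ)], (∀ μ, M μ = 2 * L ^ e) →
      ∀ (msq : ℝ), 0 < msq → msq ≤ m0sq →
        (∀ (μ : Fin (d + 1)) (lam : Tor (fine N M) → ℝ) (F D : ℝ), 0 ≤ D → (∀ y, |lam y| ≤ F) → ∀ x x' : Tor (fine N M),
          (∀ y, lam y ≠ 0 → D ≤ tdistT M (blockOf N M x) (blockOf N M y)) →
          (∀ y, lam y ≠ 0 → D ≤ tdistT M (blockOf N M x') (blockOf N M y)) →
          (tdistT (fine N M) x x' / (N : ℝ)) ^ (-α) *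
            |(N : ℝ) * (((fineOp N M (aK a L K) (((N : ℕ) : ℝ) ^ 2) msq)⁻¹ *ᵥ lam) (x' + unitVec (fine N M) μ)
                - ((fineOp N M (aK a L K) (((N : ℕ) : ℝ) ^ 2) msq)⁻¹ *ᵥ lam) x')
              - (N : ℝ) * (((fineOp N M (aK a L K) (((N : ℕ) : ℝ) ^ 2) msq)⁻¹ *ᵥ lam) (x + unitVec (fine N M) μ)
                - ((fineOp N M (aK a L K) (((N : ℕ) : ℝ) ^ 2) msq)⁻¹ *ᵥ lam) x)|
            ≤ C * Real.exp (-(δ * D)) * F) ∧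
        (∀ (ν : Fin (d + 1)) (lam : Tor (fine N M) → ℝ) (F D : ℝ), 0 ≤ D → (∀ y, |lam y| ≤ F) → ∀ x x' : Tor (fine N M),
          (∀ y, lam y ≠ 0 → D ≤ tdistT M (blockOf N M x) (blockOf N M y)) →
          (∀ y, lam y ≠ 0 → D ≤ tdistT M (blockOf N M x') (blockOf N M y)) →
          (tdistT (fine N M) x x' / (N : ℝ)) ^ (-α) *
            |((fineOp N M (aK a L K) (((N : ℕ) : ℝ) ^ 2) msq)⁻¹ *ᵥ (fun y => (N : ℝ) * (lam (y - unitVec (fine N M) ν) - lam y))) x'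
              - ((fineOp N M (aK a L K) (((N : ℕ) : ℝ) ^ 2) msq)⁻¹ *ᵥ (fun y => (N : ℝ) * (lam (y - unitVec (fine N M) ν) - lam y))) x|
            ≤ C * Real.exp (-(δ * D)) * F) ∧
        (∀ (μ μ' : Fin (d + 1)) (lam : Tor (fine N M) → ℝ) (H D : ℝ), 0 ≤ H → 0 ≤ D →
          (∀ y y', |lam y - lam y'| ≤ H * (tdistT (fine N M) y y' / (N : ℝ)) ^ ε) → ∀ x : Tor (fine N M),
          (∀ y, lam y ≠ 0 → D ≤ tdistT M (blockOf N M x) (blockOf N M y)) →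
          |(N : ℝ) * (((fineOp N M (aK a L K) (((N : ℕ) : ℝ) ^ 2) msq)⁻¹
                  *ᵥ (fun y => (N : ℝ) * (lam (y - unitVec (fine N M) μ) - lam y))) (x + unitVec (fine N M) μ')
              - ((fineOp N M (aK a L K) (((N : ℕ) : ℝ) ^ 2) msq)⁻¹
                  *ᵥ (fun y => (N : ℝ) * (lam (y - unitVec (fine N M) μ) - lam y))) x)|
            ≤ C * H * Real.exp (-(δ * D))) ∧
        (∀ (μ μ' : Fin (d + 1)) (lam : Tor (fine N M) → ℝ) (H D : ℝ), 0 ≤ H → 0 ≤ D →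
          (∀ y y', |lam y - lam y'| ≤ H * (tdistT (fine N M) y y' / (N : ℝ)) ^ α) → ∀ x x' : Tor (fine N M),
          (∀ y, lam y ≠ 0 → D ≤ tdistT M (blockOf N M x) (blockOf N M y)) →
          (∀ y, lam y ≠ 0 → D ≤ tdistT M (blockOf N M x') (blockOf N M y)) →
          (tdistT (fine N M) x x' / (N : ℝ)) ^ (-α) *
            |((N : ℝ) * (((fineOp N M (aK a L K) (((N : ℕ) : ℝ) ^ 2) msq)⁻¹
                  *ᵥ (fun y => (N : ℝ) * (lam (y - unitVec (fine N M) μ) - lam y))) (x' + unitVec (fine N M) μ')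
                - ((fineOp N M (aK a L K) (((N : ℕ) : ℝ) ^ 2) msq)⁻¹
                  *ᵥ (fun y => (N : ℝ) * (lam (y - unitVec (fine N M) μ) - lam y))) x'))
             - ((N : ℝ) * (((fineOp N M (aK a L K) (((N : ℕ) : ℝ) ^ 2) msq)⁻¹
                  *ᵥ (fun y => (N : ℝ) * (lam (y - unitVec (fine N M) μ) - lam y))) (x + unitVec (fine N M) μ')
                - ((fineOp N M (aK a L K) (((N : ℕ) : ℝ) ^ 2) msq)⁻¹
                  *ᵥ (fun y => (N : ℝ) * (lam (y - unitVec (fine N M) μ) - lam y))) x))|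
            ≤ C * H * Real.exp (-(δ * D))) := by
  obtain ⟨C₁, δ₁, hC₁, hδ₁, H₁⟩ := kingFullProp_B9Thm31_sup_holder_at_trivialU (d := d) L hLodd hL ha hm0 hα0 hα1 hε0 hε1
  obtain ⟨C₂, δ₂, hC₂, hδ₂, H₂⟩ := fullPropMixedOp_holderNorm_le (d := d) L hd hLodd hL ha hm0 hα0 hα1
  set C : ℝ := max C₁ C₂ with hCdef
  set δ : ℝ := min δ₁ δ₂ with hδdef
  have hC1 : C₁ ≤ C := le_max_left _ _
  have hC2 : C₂ ≤ C := le_max_right _ _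
  have hd1 : δ ≤ δ₁ := min_le_left _ _
  have hd2 : δ ≤ δ₂ := min_le_right _ _
  have hδ : 0 < δ := lt_min hδ₁ hδ₂
  have hC0 : 0 ≤ C := hC₁.le.trans hC1
  -- monotonicity of the two bound shapes in `(C, δ)` for `D ≥ 0`
  have hexp : ∀ {δi D : ℝ}, δ ≤ δi → 0 ≤ D → Real.exp (-(δi * D)) ≤ Real.exp (-(δ * D)) :=
    fun hδi hD => Real.exp_le_exp.mpr (neg_le_neg (mul_le_mul_of_nonneg_right hδi hD))
  have hmono : ∀ {Ci δi D X : ℝ}, Ci ≤ C → δ ≤ δi → 0 ≤ D → 0 ≤ X →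
      Ci * Real.exp (-(δi * D)) * X ≤ C * Real.exp (-(δ * D)) * X :=
    fun hCi hδi hD hX => mul_le_mul (mul_le_mul hCi (hexp hδi hD) (Real.exp_pos _).le hC0) le_rfl hX (by positivity)
  have hmono' : ∀ {Ci δi D X : ℝ}, Ci ≤ C → δ ≤ δi → 0 ≤ D → 0 ≤ X →
      Ci * X * Real.exp (-(δi * D)) ≤ C * X * Real.exp (-(δ * D)) := by
    intro Ci δi D X hCi hδi hD hX
    have := hmono hCi hδi hD hX
    linarith
  refine ⟨C, δ, lt_of_lt_of_le hC₁ hC1, hδ, ?_⟩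
  intro K hK N _ hN e M _ hM msq hmsq hcap
  obtain ⟨h1, h2, h3⟩ := H₁ K hK N hN e M hM msq hmsq hcap
  refine ⟨?_, ?_, ?_, ?_⟩
  · intro μ lam F D hD hF x x' hDx hDx'
    have hF0 : 0 ≤ F := (abs_nonneg _).trans (hF x)
    exact (h1 μ lam F D hD hF x x' hDx hDx').trans (hmono hC1 hd1 hD hF0)
  · intro ν lam F D hD hF x x' hDx hDx'
    have hF0 : 0 ≤ F := (abs_nonneg _).trans (hF x)
    exact (h2 ν lam F D hD hF x x' hDx hDx').trans (hmono hC1 hd1 hD hF0)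
  · intro μ μ' lam Hh D hH0 hD hH x hDx
    exact (h3 μ μ' lam Hh D hH0 hD hH x hDx).trans (hmono' hC1 hd1 hD hH0)
  · intro μ μ' lam Hh D hH0 hD hH x x' hDx hDx'
    exact (H₂ K hK N hN e M hM msq hmsq hcap μ μ' lam Hh hH0 hH x x' D hDx hDx').trans (hmono' hC2 hd2 hD hH0)

end Summit.QuantumFields.YangMills.BalabanUVNodes.N15KingModelRung.Curved
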